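import Literature.NumberTheory.EllipticCurves.Kato2004.EulerSystemClasses
import Literature.NumberTheory.EllipticCurves.Kato2004.IwasawaH1Reduction
import Literature.NumberTheory.GaloisRepresentations.ContinuousCorestrictionComp
import Summits.BirchSwinnertonDyer.Rank1Residual.GaloisImage.KolyvaginDerivativeAlgebra
import Summits.BirchSwinnertonDyer.Rank1Residual.GaloisImage.ContinuousCorestrictionGalois
import Summits.BirchSwinnertonDyer.Rank1Residual.GaloisImage.CyclotomicLevelInertiaGenerators
import Summits.BirchSwinnertonDyer.BirchSwinnertonDyer.Theorems.SmallImageMuTransferMuTransferX9RelativeShapiro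
import HarnessLib

/-!
# K6 crux `MuTransferX9` (stmt-BirchSwinnertonDyer-19276), skeleton v6 stub `stub_stepsTwoFourOdd`,
# input «G3a», file 2: Kato's tame norm relation `Cor z_{qp^k} = P_q(Fr_q⁻¹) z_{p^k}` moved to the layer
# `ℚ_n(μ_q)/ℚ_n` of the `ℤ_p`-extension and reduced modulo `p` — in `H¹(Gal(ℚ̄/ℚ_n), E[p])`,
# with the Euler factor acting through an INTEGER polynomial (`reduceH1 ∘ P(Fr⁻¹·) = P̄(Fr⁻¹·) ∘ reduceH1`)

Cell `bsd-smallim`, seat `bsd-smallim-koly` (gen 9).  THEOREMS ONLY (no definition, no named fact, no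
`sorry`).  HONEST FRAMING: helper toward the open stub `stub_stepsTwoFourOdd` of skeleton v6
(`a90a661b046bb403`) of the crux `MuTransferX9`; closes nothing.  Second of the «G3a» files: the
Euler-system side, still with `T_pE` / `E[p]` coefficients over the layers (file 1 =
`…X9RelativeShapiro`, the Shapiro transport; file 3 = the assembly from `Kato2004.IsEulerSystemClass`).

## What

* §1 (`W/ℚ`, `T = tateRep W p`, `ρ = W[p]`, any `U ≤ Γ_ℚ`): `reduceH1 W p U : H¹(U, T_pW) → H¹(U, W[p])`
  (k6-ty, `Kato2004/IwasawaH1Reduction`) and scalars: `nsmul_eq_zero_of_forall` (`H¹(U, X)` is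
  killed by `n` when `X` is), `reduceH1_smul` (`red (c • y) = (c mod p) • red y`),
  `reduceH1_pow_frobeniusInvOp`, and **`reduceH1_aeval_frobeniusInvOp`**: for `P ∈ ℤ_p[X]` and any
  `P̄ ∈ ℤ[X]` with `P̄ ≡ P (mod p)` coefficientwise,
  `red (P(Fr⁻¹·) y) = P̄(Fr⁻¹·) (red y)` — the Euler factor `P(Fr_q⁻¹ | T*; Fr_q⁻¹)`
  (`eulerFactorOp`, Rubin Def. 2.1.1) survives reduction as the INTEGER polynomial `P̄` in the
  operator `conjMap ρ U Fr⁻¹` (`reduceH1_eulerFactorOp`).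
* §2 (an Euler system `z` for `T_pW` over `cyclotomicLevelsRat p S`, Rubin 2.1.1 = Kato (13.1.1)):
  **`coresLe_coresLe_cons_eq_eulerFactorOp`** — for a usable place `q` (`q ∉ S`, `q ∤ 2p`), a level
  `k`, an arithmetic Frobenius `Fr` at `q`, and normal open subgroups
  `Gal(ℚ̄/ℚ(μ_{p^k}, μ_q)) ≤ U ≤ Γ ≥ Gal(ℚ̄/ℚ(μ_{p^k}))`:
  `cor_{U→Γ} (cor_{ℚ(μ_{p^k},μ_q) → U} z_{k,{q}}) = P(Fr⁻¹ | T*; Fr⁻¹) · cor_{ℚ(μ_{p^k}) → Γ} z_{k,∅}`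
  in `H¹(Γ, T_pW)` — the axiom `IsEulerSystem.cores_cons` (the tame step is ramified at `q`:
  b2b `not_subgroupIsUnramifiedAt_cyclotomicLevelsRat_level_insert`) pushed along the transfer
  (`coresLe_comp`; `cor` commutes with `conjMap Fr⁻¹`, b2b `Mackey.coresLe_conjMap`); then
  **`coresLe_reduceH1_coresLe_cons_eq_aeval`** = the same after `reduceH1` (with `P̄ ∈ ℤ[X]`), and
  **`coresLe_cons_mem_integralH1`** / **`reduceH1_coresLe_cons_mem_integralH1`**: for
  `U = N ⊓ Γ`, `N = Gal(ℚ̄/ℚ(μ_q))`, `Γ ≥ Gal(ℚ̄/ℚ(μ_{p^k}))`-type normal subgroup containing the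
  inertia at every `v ∤ p`, the class `cor_{→U} z_{k,{q}}` and its reduction are INTEGRAL
  (Kato (8.1.3): `z_m ∈ H¹(ℤ[ζ_m, 1/p], T)`, through file 1's `coresLe_mem_integralH1_of_inertia_le`).

References: K. Rubin, *Euler Systems* (2000) Def. 2.1.1, Lemma 4.4.2 [Rubin2000]; K. Kato,
Astérisque 295 (2004) (8.1.3), §13.1 (13.1.1), Ex. 13.3, §13.8 [Kato2004Asterisque]; J. Neukirch,
A. Schmidt, K. Wingberg (2008) I §5 [NeukirchSchmidtWingberg2008]; HOME/koly/MU-TRANSFER-PROOF.md §3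
(INPUT of Lemma 2: "`cor_{K/ℚ} 𝐳̄_q = P·𝐳̄_1`").
-/

-- the summit and its single problem are both named `BirchSwinnertonDyer` (registry layout D-0017)
set_option linter.dupNamespace false
set_option autoImplicit false

noncomputable section

open CategoryTheory Function Finset Polynomial
open scoped NumberField Pointwise
open Field IsDedekindDomain
open Literature.NumberTheory.GaloisRepresentations
open Literature.NumberTheory.EllipticCurves
open Literature.NumberTheory.EllipticCurves.ZpExtension
open Literature.NumberTheory.EllipticCurves.Kato2004
open Literature.NumberTheory.EllipticCurves.Kato2004.EulerSystemValues
open Rat.HeightOneSpectrum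
open Summit.BirchSwinnertonDyer.Rank1Residual.GaloisImage
open Summit.BirchSwinnertonDyer.Rank1Residual.GaloisImage.CyclotomicLevel.Rat

namespace Summit.BirchSwinnertonDyer.BirchSwinnertonDyer.Rank1Residual.TameClass

/-! ## §1 Reduction modulo `p` of scalars and of the Euler-factor operator -/

section Torsion

variable {R : Type*} [Ring R] [TopologicalSpace R]
variable {G : Type} [Group G] [TopologicalSpace G] [IsTopologicalGroup G]

/-- **`H¹(U, X)` is killed by `n` when `X` is** (on cocycles, pointwise). [cite: SerreGaloisCohomology1997, I §2.2] -/
theorem nsmul_eq_zero_of_forall (X : TopRep.{0} R G) {n : ℕ} (hX : ∀ x : X, n • x = 0)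
    (c : continuousCohomology 1 X) : n • c = 0 := by
  obtain ⟨φ, rfl⟩ := oneCocycleClass_surjective _ c
  rw [← oneCocycleClassₗ_apply, ← map_nsmul, oneCocycleClassₗ_apply, oneCocycleClass_eq_zero_iff]
  refine ⟨0, fun g ↦ ?_⟩
  rw [map_zero, sub_zero, Submodule.coe_smul_of_tower, ContinuousMap.coe_smul, Pi.smul_apply]
  exact hX _

/-- `m • c = v • c` for an integer `m` and a natural number `v` congruent modulo `n`, on an element
killed by `n`. [cite: SerreGaloisCohomology1997, I §2.2] -/
theorem zsmul_eq_nsmul_of_intCast_eq {Y : Type*} [AddCommGroup Y] {n : ℕ} {c : Y} (hc : n • c = 0)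
    {m : ℤ} {v : ℕ} (h : (m : ZMod n) = (v : ZMod n)) : m • c = v • c := by
  have hdvd : (n : ℤ) ∣ m - v := by
    rw [← ZMod.intCast_zmod_eq_zero_iff_dvd, Int.cast_sub, Int.cast_natCast, h, sub_self]
  obtain ⟨k, hk⟩ := hdvd
  have hm : m = (v : ℤ) + n * k := by linear_combination hk
  rw [hm, add_zsmul, natCast_zsmul, mul_comm, mul_zsmul, natCast_zsmul, hc, zsmul_zero, add_zero]

end Torsion

section Reduction

variable (W : WeierstrassCurve ℚ) [W.IsElliptic] (p : ℕ) [Fact p.Prime]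
  [ContinuousSMul ℤ_[p] (W.tateModule p)]

omit [W.IsElliptic] [Fact p.Prime] [ContinuousSMul ℤ_[p] (W.tateModule p)] in
/-- `H¹(U, W[p])` is killed by `p`. [cite: Kato2004Asterisque, §13.8 (p. 228)] -/
theorem natCast_smul_reduceH1_target_eq_zero (U : Subgroup (absoluteGaloisGroup ℚ))
    (c : H1 (W.torsionGaloisModule (p : ℤ)) U) : (p : ℤ) • c = 0 := by
  rw [natCast_zsmul]
  exact nsmul_eq_zero_of_forall _ (fun x ↦ AddSubgroup.torsionBy.nsmul x) c

/-- **`red (c • y) = (c mod p) • red y`** for a scalar `c ∈ ℤ_p`: write `c = (c mod p) + p·b`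
(`PadicInt.toZMod_spec`), and `red` kills `p`-multiples (`reduceH1_natCast_smul`).
[cite: Kato2004Asterisque, §13.8 (p. 228)] -/
theorem reduceH1_smul (U : Subgroup (absoluteGaloisGroup ℚ)) (c : ℤ_[p]) (y : H1 (tateRep W p) U) :
    reduceH1 W p U (c • y) = (PadicInt.toZMod c).val • reduceH1 W p U y := by
  have hspec := PadicInt.toZMod_spec c
  rw [PadicInt.maximalIdeal_eq_span_p, Ideal.mem_span_singleton] at hspec
  obtain ⟨b, hb⟩ := hspec
  have hcast : (ZMod.cast (PadicInt.toZMod c) : ℤ_[p]) = ((PadicInt.toZMod c).val : ℤ_[p]) := by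
    rw [ZMod.cast_eq_val]
  have hc : c = ((PadicInt.toZMod c).val : ℤ_[p]) + (p : ℤ_[p]) * b := by
    rw [← hcast, ← hb]; abel
  conv_lhs => rw [hc, add_smul, mul_smul, map_add, Nat.cast_smul_eq_nsmul, map_nsmul,
    reduceH1_natCast_smul, add_zero]

/-- `red ∘ (Fr⁻¹·)^k = (Fr⁻¹·)^k ∘ red` (`reduceH1_conjMap` iterated). [cite: Kato2004Asterisque, §13.8 (p. 228)] -/
theorem reduceH1_pow_frobeniusInvOp (U : Subgroup (absoluteGaloisGroup ℚ)) [U.Normal]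
    (Fr : absoluteGaloisGroup ℚ) (k : ℕ) (y : H1 (tateRep W p) U) :
    reduceH1 W p U ((frobeniusInvOp (tateRep W p) U Fr ^ k) y) =
      ((conjMap (W.torsionGaloisModule (p : ℤ)).toTopRep U Fr⁻¹ 1).hom.toLinearMap ^ k)
        (reduceH1 W p U y) := by
  induction k generalizing y with
  | zero => simp
  | succ k ih =>
    rw [pow_succ, pow_succ, Module.End.mul_apply, Module.End.mul_apply, ih]
    exact congrArg _ (reduceH1_conjMap W p U Fr⁻¹ y)

/-- **The Euler-factor operator survives reduction as an integer polynomial.**  For `P ∈ ℤ_p[X]` and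
`P̄ ∈ ℤ[X]` with the same image in `𝔽_p[X]`:
`red (P(Fr⁻¹·) y) = P̄(Fr⁻¹·) (red y)` in `H¹(U, W[p])` (`Fr⁻¹·` = `conjMap`; `H¹(U, W[p])` is killed
by `p`, so the choice of `P̄` is immaterial). [cite: Rubin2000, Def. 2.1.1] [cite: Kato2004Asterisque, §13.8 (p. 228)] -/
theorem reduceH1_aeval_frobeniusInvOp (U : Subgroup (absoluteGaloisGroup ℚ)) [U.Normal]
    (Fr : absoluteGaloisGroup ℚ) (P : ℤ_[p][X]) (Pz : ℤ[X])
    (hP : Pz.map (Int.castRingHom (ZMod p)) = P.map (PadicInt.toZMod (p := p)))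
    (y : H1 (tateRep W p) U) :
    reduceH1 W p U (aeval (frobeniusInvOp (tateRep W p) U Fr) P y) =
      aeval (conjMap (W.torsionGaloisModule (p : ℤ)).toTopRep U Fr⁻¹ 1).hom.toLinearMap Pz
        (reduceH1 W p U y) := by
  -- a common bound on the degrees
  set n : ℕ := max P.natDegree Pz.natDegree + 1 with hn
  have hnP : P.natDegree < n := by omega
  have hnPz : Pz.natDegree < n := by omega
  rw [aeval_eq_sum_range' hnP, aeval_eq_sum_range' hnPz, LinearMap.sum_apply, LinearMap.sum_apply,
    map_sum]
  refine sum_congr rfl fun i _ ↦ ?_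
  have hr : ∀ (m : ℤ) (f : Module.End ℤ (H1 (W.torsionGaloisModule (p : ℤ)) U))
      (w : H1 (W.torsionGaloisModule (p : ℤ)) U), (m • f) w = m • f w := fun _ _ _ ↦ rfl
  rw [LinearMap.smul_apply, hr, reduceH1_smul, reduceH1_pow_frobeniusInvOp]
  symm
  refine zsmul_eq_nsmul_of_intCast_eq (n := p) ?_ ?_
  · rw [← natCast_zsmul]
    exact natCast_smul_reduceH1_target_eq_zero W p U _
  · have h := congrArg (fun Q : (ZMod p)[X] ↦ Q.coeff i) hP
    simp only [coeff_map, eq_intCast, ZMod.natCast_val] at h ⊢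
    rw [h, ZMod.cast_id', id]

variable [Module.Free ℤ_[p] (W.tateModule p)] [Module.Finite ℤ_[p] (W.tateModule p)]

/-- **The Euler factor `P(Fr_q⁻¹ | T_pW*; Fr_q⁻¹)` after reduction**: for any integer lift `P̄` of
Rubin's `rubinEulerFactor (tateRep W p) χ_cyc Fr` modulo `p`,
`red (eulerFactorOp T U p Fr y) = P̄(Fr⁻¹·) (red y)`. [cite: Rubin2000, Def. 2.1.1] -/
theorem reduceH1_eulerFactorOp (U : Subgroup (absoluteGaloisGroup ℚ)) [U.Normal]
    (Fr : absoluteGaloisGroup ℚ) (Pz : ℤ[X])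
    (hP : Pz.map (Int.castRingHom (ZMod p)) =
      (rubinEulerFactor (tateRep W p).toRepresentation (cyclotomicCharacterToUnits ℚ p ℤ_[p]) Fr).map
        (PadicInt.toZMod (p := p)))
    (y : H1 (tateRep W p) U) :
    reduceH1 W p U (eulerFactorOp (tateRep W p) U p Fr y) =
      aeval (conjMap (W.torsionGaloisModule (p : ℤ)).toTopRep U Fr⁻¹ 1).hom.toLinearMap Pz
        (reduceH1 W p U y) :=
  reduceH1_aeval_frobeniusInvOp W p U Fr _ Pz hP y

end Reduction

/-! ## §2 The tame norm relation of an Euler system for `T_pW`, at a layer and modulo `p` -/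

section EulerSystem

variable (W : WeierstrassCurve ℚ) [W.IsElliptic] (p : ℕ) [Fact p.Prime]
  [ContinuousSMul ℤ_[p] (W.tateModule p)]
  [Module.Free ℤ_[p] (W.tateModule p)] [Module.Finite ℤ_[p] (W.tateModule p)]

variable {S : Set (HeightOneSpectrum (𝓞 ℚ))}
  {z : ∀ (k : ℕ) (r : (cyclotomicLevelsRat p S).Ideals),
    H1 (tateRep W p) ((cyclotomicLevelsRat p S).level k r.1)}

/-- **Kato's tame norm relation at a layer.**  For an Euler system `z` for `T_pW` over the cyclotomic
levels away from `S`, a usable place `q ∉ S` with prime `ℓ ∉ {2, p}`, a level `k`, an arithmetic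
Frobenius `Fr` at `q`, and normal open subgroups `Γ ≥ Gal(ℚ̄/ℚ(μ_{p^k}))`, `Γ ≥ U ≥ Gal(ℚ̄/ℚ(μ_{p^k},
μ_ℓ))`: `cor_{U→Γ} (cor_{→U} z_{k,{q}}) = P(Fr⁻¹ | T*; Fr⁻¹) · cor_{→Γ} z_{k,∅}` in `H¹(Γ, T_pW)` —
`IsEulerSystem.cores_cons` (the step `ℚ(μ_{p^k}) ⊂ ℚ(μ_{p^k}, μ_ℓ)` IS ramified at `q`) pushed along the
transfer. [cite: Rubin2000, Def. 2.1.1 and Lemma 4.4.2] [cite: Kato2004Asterisque, §13.1 (13.1.1) and Ex. 13.3] -/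
theorem coresLe_coresLe_cons_eq_eulerFactorOp
    (hz : IsEulerSystem (cyclotomicLevelsRat p S) (tateRep W p) p z) (k : ℕ)
    {q : HeightOneSpectrum (𝓞 ℚ)} (hq : q ∈ (cyclotomicLevelsRat p S).primes)
    (hq2 : ((primesEquiv q : Nat.Primes) : ℕ) ≠ 2)
    {Fr : absoluteGaloisGroup ℚ} (hFr : IsArithFrobAtPlace ℚ q Fr)
    {Γ U : Subgroup (absoluteGaloisGroup ℚ)} [Γ.Normal] [U.Normal]
    (hUo : IsOpen (U : Set (absoluteGaloisGroup ℚ)))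
    (h1 : (cyclotomicLevelsRat p S).level k ∅ ≤ Γ) (hUΓ : U ≤ Γ)
    (hVU : (cyclotomicLevelsRat p S).level k ((cyclotomicLevelsRat p S).idealOne.cons q hq).1 ≤ U)
    [Fintype (Γ ⧸ ((cyclotomicLevelsRat p S).level k ∅).subgroupOf Γ)]
    [Fintype (Γ ⧸ U.subgroupOf Γ)]
    [Fintype (U ⧸ ((cyclotomicLevelsRat p S).level k
      ((cyclotomicLevelsRat p S).idealOne.cons q hq).1).subgroupOf U)] :
    coresLe (tateRep W p).toTopRep hUΓ hUo
        (coresLe (tateRep W p).toTopRep hVU ((cyclotomicLevelsRat p S).isOpen_level k _)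
          (z k ((cyclotomicLevelsRat p S).idealOne.cons q hq))) =
      eulerFactorOp (tateRep W p) Γ p Fr
        (coresLe (tateRep W p).toTopRep h1 ((cyclotomicLevelsRat p S).isOpen_level k ∅)
          (z k (cyclotomicLevelsRat p S).idealOne)) := by
  classical
  let L := cyclotomicLevelsRat p S
  have hVo : IsOpen ((L.level k (L.idealOne.cons q hq).1 : Subgroup (absoluteGaloisGroup ℚ)) :
      Set (absoluteGaloisGroup ℚ)) := L.isOpen_level k _
  have h1o : IsOpen ((L.level k ∅ : Subgroup (absoluteGaloisGroup ℚ)) : Set (absoluteGaloisGroup ℚ)) :=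
    L.isOpen_level k ∅
  have hle : L.level k (L.idealOne.cons q hq).1 ≤ L.level k ∅ :=
    L.level_insert_le k L.idealOne.1 q
  -- the tame step is ramified at `q`
  have hram : ¬ SubgroupIsUnramifiedAt ℚ (L.level k (L.idealOne.cons q hq).1) q :=
    not_subgroupIsUnramifiedAt_cyclotomicLevelsRat_level_insert p S k hq2 ∅
  -- the Euler-system axiom
  have hES := hz.cores_cons k L.idealOne q hq (by simp) hram Fr hFr
  -- instances on the intermediate quotients (all `Fintype.ofFinite`, as inside `coresCons`)
  letI : Fintype (↥(L.level k ∅) ⧸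
      (L.level k (L.idealOne.cons q hq).1).subgroupOf (L.level k ∅)) :=
    Fintype.ofFinite _
  letI : Fintype (Γ ⧸ (L.level k (L.idealOne.cons q hq).1).subgroupOf Γ) := Fintype.ofFinite _
  -- push along `cor_{ℚ(μ_{p^k}) → Γ}` (the relative corestriction inside `coresCons` is `coresLe`)
  have hES' : coresLe (tateRep W p).toTopRep h1 h1o
      (coresLe (tateRep W p).toTopRep hle hVo (z k (L.idealOne.cons q hq))) =
      coresLe (tateRep W p).toTopRep h1 h1o
        (eulerFactorOp (tateRep W p) (L.level k ∅) p Fr (z k L.idealOne)) :=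
    congrArg (coresLe (tateRep W p).toTopRep h1 h1o) hES
  -- LHS: transitivity of the transfer, twice
  have hL1 : coresLe (tateRep W p).toTopRep h1 h1o
      (coresLe (tateRep W p).toTopRep hle hVo (z k (L.idealOne.cons q hq))) =
      coresLe (tateRep W p).toTopRep (hle.trans h1) hVo (z k (L.idealOne.cons q hq)) := by
    have h := LinearMap.congr_fun (coresLe_comp (tateRep W p).toTopRep hle h1 hVo h1o)
      (z k (L.idealOne.cons q hq))
    simpa only [LinearMap.comp_apply] using h
  have hL2 : coresLe (tateRep W p).toTopRep hUΓ hUo (coresLe (tateRep W p).toTopRep hVU hVo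
        (z k (L.idealOne.cons q hq))) =
      coresLe (tateRep W p).toTopRep (hVU.trans hUΓ) hVo (z k (L.idealOne.cons q hq)) := by
    have h := LinearMap.congr_fun (coresLe_comp (tateRep W p).toTopRep hVU hUΓ hVo hUo)
      (z k (L.idealOne.cons q hq))
    simpa only [LinearMap.comp_apply] using h
  -- RHS: `cor` commutes with the Euler-factor operator
  have hR : coresLe (tateRep W p).toTopRep h1 h1o
      (eulerFactorOp (tateRep W p) (L.level k ∅) p Fr (z k L.idealOne)) =
      eulerFactorOp (tateRep W p) Γ p Fr (coresLe (tateRep W p).toTopRep h1 h1o (z k L.idealOne)) :=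
    Derivative.apply_aeval_apply_eq_of_comm (coresLe (tateRep W p).toTopRep h1 h1o)
      (F := frobeniusInvOp (tateRep W p) (L.level k ∅) Fr)
      (F' := frobeniusInvOp (tateRep W p) Γ Fr)
      (fun v ↦ Derivative.Mackey.coresLe_conjMap (tateRep W p).toTopRep h1 h1o Fr⁻¹ v) _ _
  rw [hL2]
  calc coresLe (tateRep W p).toTopRep (hVU.trans hUΓ) hVo (z k (L.idealOne.cons q hq))
      = coresLe (tateRep W p).toTopRep (hle.trans h1) hVo (z k (L.idealOne.cons q hq)) := rfl
    _ = coresLe (tateRep W p).toTopRep h1 h1o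
          (coresLe (tateRep W p).toTopRep hle hVo (z k (L.idealOne.cons q hq))) := hL1.symm
    _ = coresLe (tateRep W p).toTopRep h1 h1o
          (eulerFactorOp (tateRep W p) (L.level k ∅) p Fr (z k L.idealOne)) := hES'
    _ = eulerFactorOp (tateRep W p) Γ p Fr
          (coresLe (tateRep W p).toTopRep h1 h1o (z k L.idealOne)) := hR

/-- **The tame norm relation modulo `p`**: with the data of `coresLe_coresLe_cons_eq_eulerFactorOp`
and an integer lift `P̄` of the Euler factor modulo `p`,
`cor_{U→Γ} (red (cor_{→U} z_{k,{q}})) = P̄(Fr⁻¹·) (red (cor_{→Γ} z_{k,∅}))` in `H¹(Γ, W[p])`.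
[cite: Rubin2000, Lemma 4.4.2 (proof)] [cite: Kato2004Asterisque, §13.8 (p. 228)] -/
theorem coresLe_reduceH1_coresLe_cons_eq_aeval
    (hz : IsEulerSystem (cyclotomicLevelsRat p S) (tateRep W p) p z) (k : ℕ)
    {q : HeightOneSpectrum (𝓞 ℚ)} (hq : q ∈ (cyclotomicLevelsRat p S).primes)
    (hq2 : ((primesEquiv q : Nat.Primes) : ℕ) ≠ 2)
    {Fr : absoluteGaloisGroup ℚ} (hFr : IsArithFrobAtPlace ℚ q Fr)
    (Pz : ℤ[X])
    (hP : Pz.map (Int.castRingHom (ZMod p)) =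
      (rubinEulerFactor (tateRep W p).toRepresentation (cyclotomicCharacterToUnits ℚ p ℤ_[p]) Fr).map
        (PadicInt.toZMod (p := p)))
    {Γ U : Subgroup (absoluteGaloisGroup ℚ)} [Γ.Normal] [U.Normal]
    (hUo : IsOpen (U : Set (absoluteGaloisGroup ℚ)))
    (h1 : (cyclotomicLevelsRat p S).level k ∅ ≤ Γ) (hUΓ : U ≤ Γ)
    (hVU : (cyclotomicLevelsRat p S).level k ((cyclotomicLevelsRat p S).idealOne.cons q hq).1 ≤ U)
    [Fintype (Γ ⧸ ((cyclotomicLevelsRat p S).level k ∅).subgroupOf Γ)]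
    [Fintype (Γ ⧸ U.subgroupOf Γ)]
    [Fintype (U ⧸ ((cyclotomicLevelsRat p S).level k
      ((cyclotomicLevelsRat p S).idealOne.cons q hq).1).subgroupOf U)] :
    coresLe (W.torsionGaloisModule (p : ℤ)).toTopRep hUΓ hUo
        (reduceH1 W p U
          (coresLe (tateRep W p).toTopRep hVU ((cyclotomicLevelsRat p S).isOpen_level k _)
            (z k ((cyclotomicLevelsRat p S).idealOne.cons q hq)))) =
      aeval (conjMap (W.torsionGaloisModule (p : ℤ)).toTopRep Γ Fr⁻¹ 1).hom.toLinearMap Pz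
        (reduceH1 W p Γ
          (coresLe (tateRep W p).toTopRep h1 ((cyclotomicLevelsRat p S).isOpen_level k ∅)
            (z k (cyclotomicLevelsRat p S).idealOne))) := by
  rw [← reduceH1_coresLe, coresLe_coresLe_cons_eq_eulerFactorOp W p hz k hq hq2 hFr hUo h1 hUΓ hVU,
    reduceH1_eulerFactorOp W p Γ Fr Pz hP]

omit [Module.Free ℤ_[p] (W.tateModule p)] [Module.Finite ℤ_[p] (W.tateModule p)] in
/-- **Kato's tame classes are integral at the layer `ℚ_n(μ_q)`**: if every class of the Euler system
is integral (`integralH1`: unramified away from `p` at class level, Kato (8.1.3)), then so is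
`cor_{ℚ(μ_{p^k},μ_q) → N ∩ Γ} z_{k,{q}}` for `N = Gal(ℚ̄/ℚ(μ_ℓ))` and any normal open `Γ` of finite
index containing `Gal(ℚ̄/ℚ(μ_{p^k}))` — because `(N ∩ Γ) ∩ I_𝔓 ≤ Gal(ℚ̄/ℚ(μ_{p^k}, μ_ℓ))` for every
`𝔓 ∣ v ≠ p` (b2b `mem_pLevel_of_mem_inertia`). [cite: Kato2004Asterisque, (8.1.3), §8.2 and Ex. 13.3] -/
theorem coresLe_cons_mem_integralH1
    (hint : ∀ (k : ℕ) (r : (cyclotomicLevelsRat p S).Ideals),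
      z k r ∈ integralH1 (tateRep W p) p ((cyclotomicLevelsRat p S).level k r.1))
    (k : ℕ) {q : HeightOneSpectrum (𝓞 ℚ)} (hq : q ∈ (cyclotomicLevelsRat p S).primes)
    {Γ : Subgroup (absoluteGaloisGroup ℚ)} [Γ.Normal]
    (hVU : (cyclotomicLevelsRat p S).level k ((cyclotomicLevelsRat p S).idealOne.cons q hq).1 ≤
      rootsOfUnityFixer ℚ ((primesEquiv q : Nat.Primes) : ℕ) ⊓ Γ)
    [Fintype (↥(rootsOfUnityFixer ℚ ((primesEquiv q : Nat.Primes) : ℕ) ⊓ Γ) ⧸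
      ((cyclotomicLevelsRat p S).level k ((cyclotomicLevelsRat p S).idealOne.cons q hq).1).subgroupOf
        (rootsOfUnityFixer ℚ ((primesEquiv q : Nat.Primes) : ℕ) ⊓ Γ))] :
    haveI : (rootsOfUnityFixer ℚ ((primesEquiv q : Nat.Primes) : ℕ)).Normal :=
      Subgroup.Normal.of_commutator_le _
        (haveI : NeZero ((primesEquiv q : Nat.Primes) : ℕ) := ⟨(primesEquiv q).2.ne_zero⟩
         commutator_le_rootsOfUnityFixer ℚ _)
    coresLe (tateRep W p).toTopRep hVU ((cyclotomicLevelsRat p S).isOpen_level k _)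
        (z k ((cyclotomicLevelsRat p S).idealOne.cons q hq)) ∈
      integralH1 (tateRep W p) p (rootsOfUnityFixer ℚ ((primesEquiv q : Nat.Primes) : ℕ) ⊓ Γ) := by
  classical
  refine coresLe_mem_integralH1_of_inertia_le (tateRep W p) p hVU _ (fun v hv 𝔓 h𝔓 g hg hgI ↦ ?_)
    (hint k _)
  rw [EulerSystemLevels.mem_level_iff]
  refine ⟨mem_pLevel_of_mem_inertia p S h𝔓 hgI hv k, fun q' hq' ↦ ?_⟩
  rw [EulerSystemLevels.Ideals.cons_val, EulerSystemLevels.idealOne_val, Finset.mem_insert] at hq'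
  rcases hq' with rfl | hq'
  · rw [cyclotomicLevelsRat_tameLevel]
    exact hg.1
  · exact absurd hq' (Finset.notMem_empty _)

end EulerSystem

end Summit.BirchSwinnertonDyer.BirchSwinnertonDyer.Rank1Residual.TameClass

end
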